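import Summits.ABC.Harvest.OpenQuestions
import Summits.ABC.Analytic.PolySzpiro
import Literature.NumberTheory.EllipticCurves.BSDInvariants
import Literature.NumberTheory.EllipticCurves.TamagawaFiniteIndexProofs
import Literature.NumberTheory.EllipticCurves.LeadingTerm
import Literature.NumberTheory.EllipticCurves.RegulatorProofs
import Literature.NumberTheory.EllipticCurves.MordellWeilProofs
import HarnessLib

/-!
# ABC harvest — glue G-20: the Goldfeld–Szpiro `Ш`-bound ⟹ polynomial Szpiro (rung A-PS), with
# every analytic input of Goldfeld–Szpiro's proof of their Theorem 2 as an EXPLICIT hypothesis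

`Summits/ABC/Harvest/GlueGoldfeldSzpiro.lean` — cell `abc-harv`, seat abc-harv-pr-3 (KEY GLUE-CALIB
re-pointed to G-20, director-abc g6 2026-08-27T16:45:28Z; plan pointers 16:51:10Z/16:51:22Z), namespace
`Summit.ABC.Harvest`. PROOF-ONLY (no `def`, no `sorry`, no new axiom). Row H-303 / door C10 of the
cell's table: D. Goldfeld, L. Szpiro, *Bounds for the order of the Tate–Shafarevich group*, Compositio
Math. 97 (1995) 71–87 [primary read by this seat on Numdam, `CM_1995__97_1-2_71_0.pdf`, pp. 71–77;
the displayed formulas are lost in the scan's text layer, the prose is quoted]: **Theorem 2** (p. 75)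
«Assume the bound (1.1) [`|Ш| = O(N^{1/2+ε})`] holds for modular elliptic curves defined over `ℚ`
with `ε > 0`. Then (1.2) [`|D| = O(N^{6+ε′})`] also holds with `ε′ = 12(ε + 1)`. Moreover, if we
assume the Riemann hypothesis for Rankin–Selberg zeta functions associated to modular forms of weight
3/2 then we may take `ε′ = 13ε`.» Proof (pp. 75–77, prose): periods `Ω₁` real, `Ω₂` imaginary;
via the Ramanujan cusp form, «`Δ((−1)^j Ω_k/Ω_j)` is absolutely bounded from above by a fixed constant
`c₄ > 0` and it immediately follows that [`|D| ≪ Ω_j^{-12}`]»; «it is enough to show that the bound (1.1)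
… implies that [`Ω_j ≫ N^{-3/2-ε}`-type]»; «we consider quadratic twists (mod `q`) … We would like to
choose quadratic Dirichlet characters `χ` where `E_χ` has Mordell–Weil rank `0` and `χ(−1) = (−1)^j`.
In this case [`L_E(1,χ) = c_χ Ω_j |Ш_χ| …`, (3.5)] where `Ш_χ` is the Shafarevich–Tate group of `E_χ`
and `c_χ` … depends at most on `q`. Applying the Rankin–Selberg method as in [Kohnen–Zagier, Goldfeld
1988] one obtains [a mean value] … It follows that for some twist `χ` with `q ≤ N²`, we must have
`L_E(1,χ) ≫ 1`. The nonvanishing of the L-function at `s = 1` implies that the Mordell–Weil rank of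
`E_χ` must be zero. Therefore, the assumption (1.1) for all elliptic curves defined over `ℚ` implies
that [`Ω_j ≫ …`] which implies that `Ω_E ≫ c_χ N^{-1/2-ε}`» (p. 77); under RH for the weight-3/2
Rankin–Selberg zeta function «there will exist a character `χ` of conductor `q ≤ N^ε` where
`L_E(1,χ) ≫ 1`». P. 72: «The Birch–Swinnerton-Dyer conjecture is not needed in this direction since we
may pass to the case of rank zero (where [it] is proved by Kolyvagin …) by quadratic base change.» —
REF-B (abc-harv ref-2, 2026-08-27): the step (3.5) is the rank-`0` BSD identity for the twist, used as
`L(E_χ,1) ≤ #Ш_χ · Ω_χ · ∏ c_p` (a LOWER bound for `#Ш`), which Kolyvagin's theorem does NOT supply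
(it gives finiteness and the opposite divisibility); this is the ONE conjectural input.

## What is proved here (and what is NOT)

`polySzpiroRatEff_of_goldfeldSzpiroBound`: a PARAMETRIC BOOKKEEPING THEOREM. In the tree's BSD
vocabulary (`WeierstrassCurve.realPeriodRat`, `analyticRank`, `leadingLCoeff`, `shaOrder`,
`tamagawaProduct`, `IsGloballyMinimal`; `conductorNorm ℤ`, `minimalDiscriminantNorm ℤ`) it takes
Goldfeld–Szpiro's inputs as EXPLICIT HYPOTHESES — none is asserted, none is a tree theorem today — and
derives `Summit.ABC.PolySzpiroRatEff K C` from `Summit.ABC.Harvest.GoldfeldSzpiroBound`, with the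
exponent `K` COMPUTED from the parameters of the hypotheses:

| hypothesis | content | status in print | status in tree |
|---|---|---|---|
| `hBSD` | rank-`0` BSD, LOWER-`Ш` half: `r_an(E') = 0 ⟹ Ш(E') finite ∧ L(E',1) ≤ #Ш·Ω·∏c_p` (global minimal model; `#E'(ℚ)_tors ≥ 1` and `Reg = 1` dropped, which only weakens it) | CONJECTURAL (consequence of BSD; known in many cases by Iwasawa main conjectures, not in general) — GS p. 72/76 attribute it to Kolyvagin, whose theorem gives the other half | conjecture (`BSDLeadingTermFormula` is a predicate) |
| `hP` | period–discriminant comparison `Ω(E)·|Δ_min(E)|^{1/12} ≤ c₃` | THEOREM (GS pp. 75–76: `|D| = (2π/Ω₁)^{12}|Δ(τ)|`-type identity with `Δ(τ)` bounded on `Re τ ∈ {0, ½}`; folklore) | NOT in tree |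
| `hTam` | `∏ c_p(E) ≤ c₅·|Δ_min(E)|^δ` (any `δ > 0`) | THEOREM (`c_p ≤ max(4, v_p(Δ))`, Tate's algorithm; divisor bound) | NOT in tree |
| `hT` | the TWIST STEP: for every `E` a global minimal `E'` (in print: the quadratic twist `E_χ`, `q` = conductor of `χ`) and `q ≥ 1` with `q ≤ c₈ N^α`, `r_an(E') = 0`, `L(E',1) ≥ c₂ N^{−B}`, `N(E') ≤ c₁ q² N`, `Ω(E') ≤ c₇ q^θ Ω(E)`, `|Δ_min(E')| ≤ c₆ q⁶ |Δ_min(E)|` | GS p. 76–77 CLAIM `α = 2, B = 0` from a Rankin–Selberg mean value [Kohnen–Zagier 1981; Goldfeld 1988] (no error term printed); `α = ε` under RH(RS wt 3/2); `θ = −½` is GS's `Ω_χ = Ω_j/√q` (valid for `q` prime to `N_E`; for arbitrary `q` only `θ = +½` holds); `N(E_χ) ∣ q²N`, `Δ` of the twisted model `= q⁶Δ` are standard | NOT in tree (the tree has `quadraticTwist` but no twisted `L`-value or period comparison) |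
| `hGS` | `GoldfeldSzpiroBound` = (1.1) uniformly in the rank (de Weger's Conj. 1) | OPEN (the door) | `@[conjecture]`, `OpenQuestions.lean` §7 |

Output exponent: `K = 12·(B + ½ + ε + α·(1 + 2ε + 6δ + θ)) / (1 − 12δ)`. With GS's parameters
(`α = 2`, `B = 0`, `θ = −½`): `K = 12(3/2 + 5ε + 12δ)/(1 − 12δ) → 18` as `ε, δ → 0` — this is GS's
printed `6 + ε′ = 18 + 12ε` up to the `ε`-bookkeeping (we use `#Ш_χ ≤ C·N_χ^{1/2+ε}` with
`N_χ ≤ q²N ≤ c N⁵`, GS write `N^{1/2+ε}`); corollary `polySzpiroRat_of_goldfeldSzpiroBound_GS`. With the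
worst-case period comparison `θ = +½` the same bookkeeping gives `K → 42`; with `α → 0` (RH for the
weight-3/2 Rankin–Selberg zeta function) `K → 6 + O(ε + δ)`, GS's «`ε′ = 13ε`»: corollary
`szpiro_of_goldfeldSzpiroBound_RH` concludes the tree's `SzpiroConjecture` (Szpiro `6+ε`, the A0-side
currency) from the `∀ α > 0` twist step — still modulo `hBSD` and the undischarged inputs. The lemma
`lowerSha_of_grossZagierKolyvagin_of_bsdLeadingTerm` derives `hBSD` from the tree's named fact bsd.S17
(`rank_eq_analyticRank_of_analyticRank_le_one`, Gross–Zagier–Kolyvagin) and the rank-`0` case of the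
tree predicate `WeierstrassCurve.BSDLeadingTermFormula`, pinning the ONE conjectural input. «do NOT
hard-wire a number you have not derived» (plan 16:51:10Z): every number above is the value of the
displayed `K` at the stated parameters, and the kernel checks the derivation, not the inputs.

HONESTY (D-0139/D-0140): abc is not proved by any of this; A-PS is NOT abc — «NOT abc —
POLY-SZPIRO(E = K)»; the theorem is CONDITIONAL on five hypotheses of which one (`hBSD`) is conjectural
and three (`hP`, `hTam`, `hT`) are theorems/claims in print absent from the tree; `GoldfeldSzpiroBound`
itself is open. Typed ≠ proved; a primary is a source, not an endorsement (GS's p. 72 «proved by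
Kolyvagin» is quoted, not agreed with). Ledger class for G-20: PROVED-MOD-HYPOTHESES (bookkeeping
kernel-checked; inputs named, not discharged).
-/

noncomputable section

open Literature.NumberTheory.EllipticCurves WeierstrassCurve

namespace Summit.ABC.Harvest

/-- **Where `hBSD` comes from.** The lower-`Ш` hypothesis of
`polySzpiroRatEff_of_goldfeldSzpiroBound` is implied by two tree-typed statements: the NAMED FACT
bsd.S17 `rank_eq_analyticRank_of_analyticRank_le_one` (Gross–Zagier–Kolyvagin: `r_an ≤ 1 ⟹ rank = r_an ∧
Ш finite`, a THEOREM in print, undischarged in the tree) and the rank-`0` case of the BSD LEADING-TERM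
FORMULA `W.BSDLeadingTermFormula` (a clause of the BSD CONJECTURE, tree predicate): with `Reg = 1` in
rank `0` (`regulator_eq_one_of_rank_zero`, proved) and `#E(ℚ)_tors ≥ 1` (`torsionOrder_pos_holds`,
proved), `L(E,1) = #Ш·Ω·∏c_p/#tors² ≤ #Ш·Ω·∏c_p`. So the ONE conjectural input of G-20 is exactly
«rank-`0` BSD leading term for the twists», in the LOWER-`Ш` direction (REF-B 2026-08-27); Kolyvagin's
theorem (GS p. 72 «proved by Kolyvagin») supplies the finiteness, not the inequality.
[cite: GoldfeldSzpiro1995, p. 72 and (3.5) p. 76] -/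
theorem lowerSha_of_grossZagierKolyvagin_of_bsdLeadingTerm
    (hGZK : rank_eq_analyticRank_of_analyticRank_le_one)
    (hLEAD : ∀ (W : WeierstrassCurve ℚ) [W.IsElliptic] [W.IsGloballyMinimal], W.analyticRank = 0 →
      W.BSDLeadingTermFormula) :
    ∀ (W : WeierstrassCurve ℚ) [W.IsElliptic] [W.IsGloballyMinimal], W.analyticRank = 0 →
      Finite W.sha ∧
        (W.leadingLCoeff).re ≤ (W.shaOrder : ℝ) * W.realPeriodRat * (W.tamagawaProduct : ℝ) := by
  intro W _ _ hr0
  obtain ⟨hrank, hfin⟩ := hGZK W (by omega)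
  refine ⟨hfin, ?_⟩
  have hmw : W.mordellWeilRank = 0 := by rw [hrank, hr0]
  have hReg : W.regulator = 1 := W.regulator_eq_one_of_rank_zero hmw
  have hlead : W.leadingLCoeff = (W.bsdRHS : ℂ) := hLEAD W hr0
  have hre : (W.leadingLCoeff).re = W.bsdRHS := by rw [hlead, Complex.ofReal_re]
  rw [hre, bsdRHS_def, hReg, mul_one]
  have hΩ : 0 < W.realPeriodRat := by
    haveI : (W.baseChange ℝ).IsElliptic := by rw [baseChange]; infer_instance
    rw [WeierstrassCurve.realPeriodRat_def]; exact (W.baseChange ℝ).realPeriod_pos'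
  have htors : (1 : ℝ) ≤ (W.torsionOrder : ℝ) := by exact_mod_cast W.torsionOrder_pos_holds
  have hnum : 0 ≤ (W.shaOrder : ℝ) * W.realPeriodRat * (W.tamagawaProduct : ℝ) := by positivity
  calc (W.shaOrder : ℝ) * W.realPeriodRat * (W.tamagawaProduct : ℝ) / (W.torsionOrder : ℝ) ^ 2
      ≤ (W.shaOrder : ℝ) * W.realPeriodRat * (W.tamagawaProduct : ℝ) / 1 :=
        div_le_div_of_nonneg_left hnum one_pos (by nlinarith)
    _ = _ := div_one _

/-- **Goldfeld–Szpiro Theorem 2, as parametric bookkeeping** (row H-303, glue G-20): if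
(`hGS`) `#Ш(E) ≤ C·N_E^{1/2+ε}` for all `E/ℚ` with finite `Ш` (`GoldfeldSzpiroBound`), and — HYPOTHESES,
not tree theorems — (`hBSD`) the rank-`0` BSD lower-`Ш` half `L(E',1) ≤ #Ш·Ω·∏c_p` for global minimal
models of analytic rank `0` [conjectural], (`hP`) `Ω(E)|Δ_min|^{1/12} ≤ c₃` [GS pp. 75–76], (`hTam`)
`∏c_p ≤ c₅|Δ_min|^δ` [Tate's algorithm + divisor bound], (`hT`) for every global minimal `E` a global
minimal `E'` of analytic rank `0` and a real `q ∈ [1, c₈N^α]` with `L(E',1) ≥ c₂N^{−B}`,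
`N' ≤ c₁q²N`, `Ω(E') ≤ c₇q^θΩ(E)`, `|Δ'_min| ≤ c₆q⁶|Δ_min|` [GS p. 76–77: `E' = E_χ`, `q ≤ N²`, i.e.
`α = 2`, `B = 0`, `θ = −½`], then `log|Δ_min(E)| ≤ K·log N_E + C` for every `E/ℚ` with
`K = 12(B + ½ + ε + α(1 + 2ε + 6δ + θ))/(1 − 12δ)`, i.e. `Summit.ABC.PolySzpiroRatEff K C`.
Proof: pass to a global minimal model (`hasGlobalMinimalModel_rat_holds`, `conductorNorm_smul_rat`,
`minimalDiscriminantNorm_smul_rat`), take logarithms of the seven inequalities and add them with the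
non-negative weights `½ + ε`, `δ`, `1 + 2ε + 6δ + θ`. Side conditions: `0 < ε`, `0 ≤ δ < 1/12`,
`0 ≤ 1 + 2ε + 6δ + θ`, positive constants. NOT abc; A-PS is NOT abc; conditional as stated.
[cite: GoldfeldSzpiro1995, Thm 2 (p. 75) and its proof (pp. 75–77)] -/
theorem polySzpiroRatEff_of_goldfeldSzpiroBound
    {ε δ α θ B c₁ c₂ c₃ c₅ c₆ c₇ c₈ : ℝ}
    (hε : 0 < ε) (hδ : 0 ≤ δ) (hδ' : 12 * δ < 1) (he : 0 ≤ 1 + 2 * ε + 6 * δ + θ)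
    (hc₁ : 0 < c₁) (hc₂ : 0 < c₂) (hc₅ : 0 < c₅) (hc₆ : 0 < c₆) (hc₇ : 0 < c₇) (hc₈ : 0 < c₈)
    (hGS : GoldfeldSzpiroBound)
    (hBSD : ∀ (W : WeierstrassCurve ℚ) [W.IsElliptic] [W.IsGloballyMinimal], W.analyticRank = 0 →
      Finite W.sha ∧
        (W.leadingLCoeff).re ≤ (W.shaOrder : ℝ) * W.realPeriodRat * (W.tamagawaProduct : ℝ))
    (hP : ∀ (W : WeierstrassCurve ℚ) [W.IsElliptic] [W.IsGloballyMinimal],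
      W.realPeriodRat * (W.minimalDiscriminantNorm ℤ : ℝ) ^ (1 / 12 : ℝ) ≤ c₃)
    (hTam : ∀ (W : WeierstrassCurve ℚ) [W.IsElliptic] [W.IsGloballyMinimal],
      (W.tamagawaProduct : ℝ) ≤ c₅ * (W.minimalDiscriminantNorm ℤ : ℝ) ^ δ)
    (hT : ∀ (W : WeierstrassCurve ℚ) [W.IsElliptic] [W.IsGloballyMinimal],
      ∃ (W' : WeierstrassCurve ℚ) (q : ℝ), W'.IsElliptic ∧ W'.IsGloballyMinimal ∧
        1 ≤ q ∧ q ≤ c₈ * (W.conductorNorm ℤ : ℝ) ^ α ∧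
        W'.analyticRank = 0 ∧
        c₂ * (W.conductorNorm ℤ : ℝ) ^ (-B) ≤ (W'.leadingLCoeff).re ∧
        (W'.conductorNorm ℤ : ℝ) ≤ c₁ * q ^ 2 * (W.conductorNorm ℤ : ℝ) ∧
        W'.realPeriodRat ≤ c₇ * q ^ θ * W.realPeriodRat ∧
        (W'.minimalDiscriminantNorm ℤ : ℝ) ≤ c₆ * q ^ 6 * (W.minimalDiscriminantNorm ℤ : ℝ)) :
    ∃ C : ℝ, Summit.ABC.PolySzpiroRatEff
      (12 * (B + (1 / 2 + ε) + α * (1 + 2 * ε + 6 * δ + θ)) / (1 - 12 * δ)) C := by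
  obtain ⟨C₀, hC₀⟩ := hGS ε hε
  set Cg : ℝ := max C₀ 1 with hCg
  have hCg1 : 1 ≤ Cg := le_max_right _ _
  -- the additive constant, collected from the log-form of every input
  set X₀ : ℝ := Real.log Cg + Real.log c₅ + Real.log c₇ + Real.log c₃ - Real.log c₂
      + (1 / 2 + ε) * Real.log c₁ + δ * Real.log c₆ + (1 + 2 * ε + 6 * δ + θ) * Real.log c₈
    with hX₀
  have h12 : (0 : ℝ) < 1 / 12 - δ := by linarith
  refine ⟨X₀ / (1 / 12 - δ), ?_⟩
  intro W₀ _
  -- pass to a global minimal model `W = Cv • W₀` (same conductor, same minimal discriminant)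
  obtain ⟨Cv, hCv⟩ := hasGlobalMinimalModel_rat_holds W₀
  haveI := hCv
  rw [← conductorNorm_smul_rat W₀ Cv, ← minimalDiscriminantNorm_smul_rat W₀ Cv]
  set W : WeierstrassCurve ℚ := Cv • W₀ with hWdef
  -- the data
  obtain ⟨W', q, hE', hM', hq1, hqN, hr0, hL, hN', hΩ', hΔ'⟩ := hT W
  haveI := hE'
  haveI := hM'
  obtain ⟨hfin, hbsd⟩ := hBSD W' hr0
  have hS : (W'.shaOrder : ℝ) ≤ Cg * (W'.conductorNorm ℤ : ℝ) ^ (1 / 2 + ε) :=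
    (hC₀ W' hfin).trans (mul_le_mul_of_nonneg_right (le_max_left _ _) (Real.rpow_nonneg
      (by positivity) _))
  have hPW := hP W
  have hTW := hTam W'
  -- positivity
  have hN : (1 : ℝ) ≤ (W.conductorNorm ℤ : ℝ) := by
    exact_mod_cast (W.conductorNorm_pos_holds : 0 < W.conductorNorm ℤ)
  have hΔ : (1 : ℝ) ≤ (W.minimalDiscriminantNorm ℤ : ℝ) := by
    exact_mod_cast (W.minimalDiscriminantNorm_pos_holds : 0 < W.minimalDiscriminantNorm ℤ)
  have hN'1 : (1 : ℝ) ≤ (W'.conductorNorm ℤ : ℝ) := by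
    exact_mod_cast (W'.conductorNorm_pos_holds : 0 < W'.conductorNorm ℤ)
  have hΔ'1 : (1 : ℝ) ≤ (W'.minimalDiscriminantNorm ℤ : ℝ) := by
    exact_mod_cast (W'.minimalDiscriminantNorm_pos_holds : 0 < W'.minimalDiscriminantNorm ℤ)
  have hΩ : 0 < W.realPeriodRat := by
    haveI : (W.baseChange ℝ).IsElliptic := by rw [baseChange]; infer_instance
    rw [WeierstrassCurve.realPeriodRat_def]; exact (W.baseChange ℝ).realPeriod_pos'
  have hΩ'pos : 0 < W'.realPeriodRat := by
    haveI : (W'.baseChange ℝ).IsElliptic := by rw [baseChange]; infer_instance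
    rw [WeierstrassCurve.realPeriodRat_def]; exact (W'.baseChange ℝ).realPeriod_pos'
  have hSpos : (0 : ℝ) < (W'.shaOrder : ℝ) := by exact_mod_cast W'.shaOrder_pos hfin
  have hTpos : (0 : ℝ) < (W'.tamagawaProduct : ℝ) := by exact_mod_cast W'.tamagawaProduct_pos'
  have hq : 0 < q := by linarith
  have hLlow : 0 < c₂ * (W.conductorNorm ℤ : ℝ) ^ (-B) := by positivity
  have hLpos : 0 < (W'.leadingLCoeff).re := lt_of_lt_of_le hLlow hL
  -- log-form of every input
  have e1 : Real.log (W'.leadingLCoeff).re ≤ Real.log (W'.shaOrder : ℝ)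
      + Real.log W'.realPeriodRat + Real.log (W'.tamagawaProduct : ℝ) := by
    have := Real.log_le_log hLpos hbsd
    rwa [Real.log_mul (by positivity) hTpos.ne', Real.log_mul hSpos.ne' hΩ'pos.ne'] at this
  have e2 : Real.log (W'.shaOrder : ℝ) ≤
      Real.log Cg + (1 / 2 + ε) * Real.log (W'.conductorNorm ℤ : ℝ) := by
    have := Real.log_le_log hSpos hS
    rwa [Real.log_mul (by positivity) (by positivity), Real.log_rpow (by positivity)] at this
  have e3 : Real.log (W'.tamagawaProduct : ℝ) ≤
      Real.log c₅ + δ * Real.log (W'.minimalDiscriminantNorm ℤ : ℝ) := by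
    have := Real.log_le_log hTpos hTW
    rwa [Real.log_mul hc₅.ne' (by positivity), Real.log_rpow (by positivity)] at this
  have e4 : Real.log W.realPeriodRat + (1 / 12 : ℝ) * Real.log (W.minimalDiscriminantNorm ℤ : ℝ)
      ≤ Real.log c₃ := by
    have := Real.log_le_log (by positivity) hPW
    rwa [Real.log_mul hΩ.ne' (by positivity), Real.log_rpow (by positivity)] at this
  have e5 : Real.log c₂ + (-B) * Real.log (W.conductorNorm ℤ : ℝ) ≤
      Real.log (W'.leadingLCoeff).re := by
    have := Real.log_le_log hLlow hL
    rwa [Real.log_mul hc₂.ne' (by positivity), Real.log_rpow (by positivity)] at this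
  have e6 : Real.log (W'.conductorNorm ℤ : ℝ) ≤
      Real.log c₁ + 2 * Real.log q + Real.log (W.conductorNorm ℤ : ℝ) := by
    have := Real.log_le_log (by positivity) hN'
    rwa [Real.log_mul (by positivity) (by positivity), Real.log_mul hc₁.ne' (by positivity),
      Real.log_pow] at this
  have e7 : Real.log W'.realPeriodRat ≤ Real.log c₇ + θ * Real.log q + Real.log W.realPeriodRat := by
    have := Real.log_le_log hΩ'pos hΩ'
    rwa [Real.log_mul (by positivity) hΩ.ne', Real.log_mul hc₇.ne' (by positivity),
      Real.log_rpow hq] at this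
  have e8 : Real.log (W'.minimalDiscriminantNorm ℤ : ℝ) ≤
      Real.log c₆ + 6 * Real.log q + Real.log (W.minimalDiscriminantNorm ℤ : ℝ) := by
    have := Real.log_le_log (by positivity) hΔ'
    rwa [Real.log_mul (by positivity) (by positivity), Real.log_mul hc₆.ne' (by positivity),
      Real.log_pow] at this
  have e9 : Real.log q ≤ Real.log c₈ + α * Real.log (W.conductorNorm ℤ : ℝ) := by
    have := Real.log_le_log hq hqN
    rwa [Real.log_mul hc₈.ne' (by positivity), Real.log_rpow (by positivity)] at this
  have hLq : 0 ≤ Real.log q := Real.log_nonneg hq1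
  have hLN : 0 ≤ Real.log (W.conductorNorm ℤ : ℝ) := Real.log_nonneg hN
  -- multiplied versions (non-negative symbolic coefficients)
  have m6 := mul_le_mul_of_nonneg_left e6 (by positivity : (0 : ℝ) ≤ 1 / 2 + ε)
  have m8 := mul_le_mul_of_nonneg_left e8 hδ
  have m9 := mul_le_mul_of_nonneg_left e9 he
  -- assemble: `(1/12 − δ)·log Δ ≤ X₀ + K₀·log N`
  have main : (1 / 12 - δ) * Real.log (W.minimalDiscriminantNorm ℤ : ℝ) ≤
      X₀ + (B + (1 / 2 + ε) + α * (1 + 2 * ε + 6 * δ + θ)) * Real.log (W.conductorNorm ℤ : ℝ) := by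
    rw [hX₀]
    linarith [e1, e2, e3, e4, e5, m6, e7, m8, m9]
  -- divide by `1/12 − δ > 0`
  have hgoal : Real.log (W.minimalDiscriminantNorm ℤ : ℝ) ≤
      (X₀ + (B + (1 / 2 + ε) + α * (1 + 2 * ε + 6 * δ + θ)) * Real.log (W.conductorNorm ℤ : ℝ))
        / (1 / 12 - δ) := by
    rw [le_div_iff₀ h12]; linarith
  have heq : (X₀ + (B + (1 / 2 + ε) + α * (1 + 2 * ε + 6 * δ + θ)) * Real.log (W.conductorNorm ℤ : ℝ))
        / (1 / 12 - δ) =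
      12 * (B + (1 / 2 + ε) + α * (1 + 2 * ε + 6 * δ + θ)) / (1 - 12 * δ)
        * Real.log (W.conductorNorm ℤ : ℝ) + X₀ / (1 / 12 - δ) := by
    have h1 : (1 : ℝ) - 12 * δ ≠ 0 := by linarith
    have h2 : (1 : ℝ) / 12 - δ ≠ 0 := h12.ne'
    field_simp
    ring
  rw [heq] at hgoal
  exact hgoal

/-- **GS's own parameters** (p. 76–77: a twist of conductor `q ≤ N²` with `L_E(1,χ) ≫ 1` and
`Ω_χ = Ω_j/√q`): `α = 2`, `B = 0`, `θ = −½` in `polySzpiroRatEff_of_goldfeldSzpiroBound` give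
`K = 12(3/2 + 5ε + 12δ)/(1 − 12δ)` (`→ 18` as `ε, δ → 0`: Goldfeld–Szpiro's printed `N^{18+12ε}` up to
`ε`-bookkeeping), hence `Summit.ABC.PolySzpiroRat`. Same hypotheses; NOT abc — POLY-SZPIRO(E ≈ 18);
conditional as stated. [cite: GoldfeldSzpiro1995, Thm 2 (p. 75), proof pp. 76–77] -/
theorem polySzpiroRat_of_goldfeldSzpiroBound_GS
    {ε δ c₁ c₂ c₃ c₅ c₆ c₇ c₈ : ℝ}
    (hε : 0 < ε) (hδ : 0 ≤ δ) (hδ' : 12 * δ < 1)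
    (hc₁ : 0 < c₁) (hc₂ : 0 < c₂) (hc₅ : 0 < c₅) (hc₆ : 0 < c₆) (hc₇ : 0 < c₇) (hc₈ : 0 < c₈)
    (hGS : GoldfeldSzpiroBound)
    (hBSD : ∀ (W : WeierstrassCurve ℚ) [W.IsElliptic] [W.IsGloballyMinimal], W.analyticRank = 0 →
      Finite W.sha ∧
        (W.leadingLCoeff).re ≤ (W.shaOrder : ℝ) * W.realPeriodRat * (W.tamagawaProduct : ℝ))
    (hP : ∀ (W : WeierstrassCurve ℚ) [W.IsElliptic] [W.IsGloballyMinimal],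
      W.realPeriodRat * (W.minimalDiscriminantNorm ℤ : ℝ) ^ (1 / 12 : ℝ) ≤ c₃)
    (hTam : ∀ (W : WeierstrassCurve ℚ) [W.IsElliptic] [W.IsGloballyMinimal],
      (W.tamagawaProduct : ℝ) ≤ c₅ * (W.minimalDiscriminantNorm ℤ : ℝ) ^ δ)
    (hT : ∀ (W : WeierstrassCurve ℚ) [W.IsElliptic] [W.IsGloballyMinimal],
      ∃ (W' : WeierstrassCurve ℚ) (q : ℝ), W'.IsElliptic ∧ W'.IsGloballyMinimal ∧
        1 ≤ q ∧ q ≤ c₈ * (W.conductorNorm ℤ : ℝ) ^ 2 ∧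
        W'.analyticRank = 0 ∧
        c₂ ≤ (W'.leadingLCoeff).re ∧
        (W'.conductorNorm ℤ : ℝ) ≤ c₁ * q ^ 2 * (W.conductorNorm ℤ : ℝ) ∧
        W'.realPeriodRat ≤ c₇ * q ^ (-(1 / 2) : ℝ) * W.realPeriodRat ∧
        (W'.minimalDiscriminantNorm ℤ : ℝ) ≤ c₆ * q ^ 6 * (W.minimalDiscriminantNorm ℤ : ℝ)) :
    ∃ C : ℝ, Summit.ABC.PolySzpiroRatEff (12 * (3 / 2 + 5 * ε + 12 * δ) / (1 - 12 * δ)) C ∧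
      Summit.ABC.PolySzpiroRat := by
  have he : (0 : ℝ) ≤ 1 + 2 * ε + 6 * δ + (-(1 / 2)) := by linarith
  have hT' : ∀ (W : WeierstrassCurve ℚ) [W.IsElliptic] [W.IsGloballyMinimal],
      ∃ (W' : WeierstrassCurve ℚ) (q : ℝ), W'.IsElliptic ∧ W'.IsGloballyMinimal ∧
        1 ≤ q ∧ q ≤ c₈ * (W.conductorNorm ℤ : ℝ) ^ (2 : ℝ) ∧
        W'.analyticRank = 0 ∧
        c₂ * (W.conductorNorm ℤ : ℝ) ^ (-(0 : ℝ)) ≤ (W'.leadingLCoeff).re ∧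
        (W'.conductorNorm ℤ : ℝ) ≤ c₁ * q ^ 2 * (W.conductorNorm ℤ : ℝ) ∧
        W'.realPeriodRat ≤ c₇ * q ^ (-(1 / 2) : ℝ) * W.realPeriodRat ∧
        (W'.minimalDiscriminantNorm ℤ : ℝ) ≤ c₆ * q ^ 6 * (W.minimalDiscriminantNorm ℤ : ℝ) := by
    intro W _ _
    obtain ⟨W', q, h1, h2, h3, h4, h5, h6, h7, h8, h9⟩ := hT W
    refine ⟨W', q, h1, h2, h3, by rwa [Real.rpow_two], h5, ?_, h7, h8, h9⟩
    rwa [neg_zero, Real.rpow_zero, mul_one]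
  obtain ⟨C, hC⟩ := polySzpiroRatEff_of_goldfeldSzpiroBound (α := 2) (θ := -(1 / 2)) (B := 0)
    hε hδ hδ' he hc₁ hc₂ hc₅ hc₆ hc₇ hc₈ hGS hBSD hP hTam hT'
  have hK : 12 * ((0 : ℝ) + (1 / 2 + ε) + 2 * (1 + 2 * ε + 6 * δ + -(1 / 2))) / (1 - 12 * δ) =
      12 * (3 / 2 + 5 * ε + 12 * δ) / (1 - 12 * δ) := by ring
  rw [hK] at hC
  exact ⟨C, hC, Summit.ABC.polySzpiroRat_of_eff hC⟩

/-- From polynomial Szpiro with every exponent `> 6` to **Szpiro `6+ε`** (`SzpiroConjecture`,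
Silverman AEC VIII.11.1): if for every `η > 0` some `K ≤ 6 + η` and `C` satisfy
`PolySzpiroRatEff K C`, then `|Δ_min| ≤ e^C · N^{6+η}` (exponentiate; `log N ≥ 0`). [folklore] -/
theorem szpiro_of_forall_polySzpiroRatEff
    (h : ∀ η : ℝ, 0 < η → ∃ K C : ℝ, K ≤ 6 + η ∧ Summit.ABC.PolySzpiroRatEff K C) :
    SzpiroConjecture := by
  intro η hη
  obtain ⟨K, C, hK, hKC⟩ := h η hη
  refine ⟨Real.exp C, fun W _ => ?_⟩
  have hΔ : (0 : ℝ) < (W.minimalDiscriminantNorm ℤ : ℝ) := by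
    exact_mod_cast (W.minimalDiscriminantNorm_pos_holds : 0 < W.minimalDiscriminantNorm ℤ)
  have hN : (0 : ℝ) < (W.conductorNorm ℤ : ℝ) := by
    exact_mod_cast (W.conductorNorm_pos_holds : 0 < W.conductorNorm ℤ)
  have hN1 : (1 : ℝ) ≤ (W.conductorNorm ℤ : ℝ) := by
    exact_mod_cast (W.conductorNorm_pos_holds : 0 < W.conductorNorm ℤ)
  have hlogN : 0 ≤ Real.log (W.conductorNorm ℤ : ℝ) := Real.log_nonneg hN1
  have h1 := hKC W
  have h2 : Real.log (W.minimalDiscriminantNorm ℤ : ℝ) ≤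
      (6 + η) * Real.log (W.conductorNorm ℤ : ℝ) + C := by
    nlinarith [mul_le_mul_of_nonneg_right hK hlogN]
  calc (W.minimalDiscriminantNorm ℤ : ℝ)
      = Real.exp (Real.log (W.minimalDiscriminantNorm ℤ : ℝ)) := (Real.exp_log hΔ).symm
    _ ≤ Real.exp ((6 + η) * Real.log (W.conductorNorm ℤ : ℝ) + C) := Real.exp_le_exp.mpr h2
    _ = Real.exp C * (W.conductorNorm ℤ : ℝ) ^ (6 + η) := by
        rw [Real.rpow_def_of_pos hN, ← Real.exp_add]; congr 1; ring

/-- **GS under «the Riemann hypothesis for Rankin–Selberg zeta functions of weight 3/2»** (Thm 2,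
second clause, p. 75/77: «there will exist a character `χ` of conductor `q ≤ N^ε` where `L_E(1,χ) ≫ 1`»,
«we may take `ε′ = 13ε`»): if the twist step `hT` holds with `q ≤ c₈(α)·N^α` for EVERY `α > 0`, the
Tamagawa bound for every `δ > 0`, and `hGS`, `hBSD`, `hP` as in
`polySzpiroRatEff_of_goldfeldSzpiroBound` (`θ = −½`, `B = 0`), then choosing `ε = δ = α = t`,
`t = min(1/100, η/200)`, gives `K(t) ≤ 6 + η` for every `η > 0`, hence **Szpiro `6+ε`**
(`SzpiroConjecture`, the A0-side currency of LADDER-ABC) — CONDITIONAL on the same inputs PLUS the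
RH(RS)-strength twist existence; abc is not proved by any of this (and Szpiro `6+ε` gives abc only with
exponent `6/5`-type losses, `abc_sixFifths_of_szpiro`); typed ≠ proved.
[cite: GoldfeldSzpiro1995, Thm 2 (p. 75), second clause; proof p. 77] -/
theorem szpiro_of_goldfeldSzpiroBound_RH
    {c₁ c₂ c₃ c₆ c₇ : ℝ} (hc₁ : 0 < c₁) (hc₂ : 0 < c₂) (hc₆ : 0 < c₆) (hc₇ : 0 < c₇)
    (hGS : GoldfeldSzpiroBound)
    (hBSD : ∀ (W : WeierstrassCurve ℚ) [W.IsElliptic] [W.IsGloballyMinimal], W.analyticRank = 0 →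
      Finite W.sha ∧
        (W.leadingLCoeff).re ≤ (W.shaOrder : ℝ) * W.realPeriodRat * (W.tamagawaProduct : ℝ))
    (hP : ∀ (W : WeierstrassCurve ℚ) [W.IsElliptic] [W.IsGloballyMinimal],
      W.realPeriodRat * (W.minimalDiscriminantNorm ℤ : ℝ) ^ (1 / 12 : ℝ) ≤ c₃)
    (hTam : ∀ δ : ℝ, 0 < δ → ∃ c₅ : ℝ, 0 < c₅ ∧
      ∀ (W : WeierstrassCurve ℚ) [W.IsElliptic] [W.IsGloballyMinimal],
        (W.tamagawaProduct : ℝ) ≤ c₅ * (W.minimalDiscriminantNorm ℤ : ℝ) ^ δ)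
    (hT : ∀ α : ℝ, 0 < α → ∃ c₈ : ℝ, 0 < c₈ ∧
      ∀ (W : WeierstrassCurve ℚ) [W.IsElliptic] [W.IsGloballyMinimal],
      ∃ (W' : WeierstrassCurve ℚ) (q : ℝ), W'.IsElliptic ∧ W'.IsGloballyMinimal ∧
        1 ≤ q ∧ q ≤ c₈ * (W.conductorNorm ℤ : ℝ) ^ α ∧
        W'.analyticRank = 0 ∧
        c₂ ≤ (W'.leadingLCoeff).re ∧
        (W'.conductorNorm ℤ : ℝ) ≤ c₁ * q ^ 2 * (W.conductorNorm ℤ : ℝ) ∧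
        W'.realPeriodRat ≤ c₇ * q ^ (-(1 / 2) : ℝ) * W.realPeriodRat ∧
        (W'.minimalDiscriminantNorm ℤ : ℝ) ≤ c₆ * q ^ 6 * (W.minimalDiscriminantNorm ℤ : ℝ)) :
    SzpiroConjecture := by
  refine szpiro_of_forall_polySzpiroRatEff fun η hη => ?_
  set t : ℝ := min (1 / 100) (η / 200) with ht
  have ht0 : 0 < t := lt_min (by norm_num) (by positivity)
  have ht1 : t ≤ 1 / 100 := min_le_left _ _
  have ht2 : t ≤ η / 200 := min_le_right _ _
  have ht12 : 12 * t < 1 := by linarith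
  have he : (0 : ℝ) ≤ 1 + 2 * t + 6 * t + (-(1 / 2)) := by linarith
  obtain ⟨c₅, hc₅, hTam'⟩ := hTam t ht0
  obtain ⟨c₈, hc₈, hT'⟩ := hT t ht0
  have hT'' : ∀ (W : WeierstrassCurve ℚ) [W.IsElliptic] [W.IsGloballyMinimal],
      ∃ (W' : WeierstrassCurve ℚ) (q : ℝ), W'.IsElliptic ∧ W'.IsGloballyMinimal ∧
        1 ≤ q ∧ q ≤ c₈ * (W.conductorNorm ℤ : ℝ) ^ t ∧
        W'.analyticRank = 0 ∧
        c₂ * (W.conductorNorm ℤ : ℝ) ^ (-(0 : ℝ)) ≤ (W'.leadingLCoeff).re ∧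
        (W'.conductorNorm ℤ : ℝ) ≤ c₁ * q ^ 2 * (W.conductorNorm ℤ : ℝ) ∧
        W'.realPeriodRat ≤ c₇ * q ^ (-(1 / 2) : ℝ) * W.realPeriodRat ∧
        (W'.minimalDiscriminantNorm ℤ : ℝ) ≤ c₆ * q ^ 6 * (W.minimalDiscriminantNorm ℤ : ℝ) := by
    intro W _ _
    obtain ⟨W', q, h1, h2, h3, h4, h5, h6, h7, h8, h9⟩ := hT' W
    refine ⟨W', q, h1, h2, h3, h4, h5, ?_, h7, h8, h9⟩
    rwa [neg_zero, Real.rpow_zero, mul_one]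
  obtain ⟨C, hC⟩ := polySzpiroRatEff_of_goldfeldSzpiroBound (ε := t) (δ := t) (α := t)
    (θ := -(1 / 2)) (B := 0) ht0 ht0.le ht12 he hc₁ hc₂ hc₅ hc₆ hc₇ hc₈ hGS hBSD hP hTam' hT''
  refine ⟨_, C, ?_, hC⟩
  -- `K(t) = (6 + 18t + 96t²)/(1 − 12t) ≤ 6 + η` for `t ≤ 1/100`, `t ≤ η/200`
  rw [div_le_iff₀ (by linarith : (0 : ℝ) < 1 - 12 * t)]
  nlinarith [mul_le_mul_of_nonneg_left ht1 ht0.le, mul_le_mul_of_nonneg_left ht1 hη.le, ht2]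

end Summit.ABC.Harvest
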